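import Summits.ValiantsHypothesis.ValiantsHypothesis.Theorems.DefinabilityGapAlterationStep
import Summits.ValiantsHypothesis.ValiantsHypothesis.Theorems.DefinabilityGapMovers
import HarnessLib

/-!
# Definability gap, ROAD P: ITERATED re-pick rounds, deterministically (N1 v2 §(5), PLAN (d) v3)

One round replaces `r` by `r₂ = mergeRows Mv r r'` with `Mv = movers T s₀ r key`, the movers'
new rows avoiding the rows blocked under `r`.  This file proves the bookkeeping that lets the
round be ITERATED (three rounds suffice numerically: `#movers` goes `O(m) → O(1) → 0`):

* `collision_merge` — every collision under `r₂` is a mover–mover collision under `r'`;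
* `movers_merge_subset` — `movers T s₀ r₂ key ⊆ movers (T ∩ Mv) s₀ r' key` (so the next
  round's movers are this round's colliding movers) and `card_movers_merge_le`
  (`#movers(r₂) ≤ collCount (T ∩ Mv) s₀ r'`);
* `blockedRows_merge_subset` — `blockedRows T c r₂ s₀ ⊆ blockedRows T c r s₀ ∪
  blockedRows (T ∩ Mv) c r' s₀` (the re-pick sets shrink by the movers' landings only);
* `free_of_movers_eq_empty` / `injective_of_movers_eq_empty` — TERMINATION: no movers ⇒ the
  pivot column is free at every pivot row and the pivots are injective (clause 1).
-/

namespace Summit.ValiantsHypothesis.ValiantsHypothesis.Theorems.DefinabilityGapRounds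

open Finset
open Literature.Computability.AlgebraicComplexity Literature.Computability.MetaComplexity
open Summit.ValiantsHypothesis.ValiantsHypothesis.Theorems.DefinabilityGapAffineRung
open Summit.ValiantsHypothesis.ValiantsHypothesis.Theorems.DefinabilityGapPivotCertificate
open Summit.ValiantsHypothesis.ValiantsHypothesis.Theorems.DefinabilityGapPivotAdmissible
open Summit.ValiantsHypothesis.ValiantsHypothesis.Theorems.DefinabilityGapCrowdedFree
open Summit.ValiantsHypothesis.ValiantsHypothesis.Theorems.DefinabilityGapPivotColumn
open Summit.ValiantsHypothesis.ValiantsHypothesis.Theorems.DefinabilityGapMovers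
open Summit.ValiantsHypothesis.ValiantsHypothesis.Theorems.DefinabilityGapAlterationStep

variable {m : ℕ}

/-! ## 1. Collisions after a merge are mover–mover collisions -/

open scoped Classical in
/-- **Every collision under the merged assignment is a mover–mover collision under `r'`**,
provided the movers' new rows avoid the rows blocked under `r`. [this file] -/
theorem collision_merge {T : Finset (Fin 3 → Fin (qOf m))} {s₀ : Fin m}
    {r r' : (Fin 3 → Fin (qOf m)) → Fin m} (key : (Fin 3 → Fin (qOf m)) → ℕ)
    (ha : ∀ c ∈ movers T s₀ r key, r' c ∉ blockedRows T c r s₀)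
    {c c' : Fin 3 → Fin (qOf m)} (hc : c ∈ T)
    (hc' : c' ∈ coCurves T c (mergeRows (movers T s₀ r key) r r' c, s₀))
    (hcoll : mergeRows (movers T s₀ r key) r r' c' = mergeRows (movers T s₀ r key) r r' c) :
    c ∈ movers T s₀ r key ∧ c' ∈ movers T s₀ r key ∧
      c' ∈ coCurves (T ∩ movers T s₀ r key) c (r' c, s₀) ∧ r' c' = r' c := by
  set Mv := movers T s₀ r key with hMv
  have hc'T : c' ∈ T := (mem_coCurves.mp hc').1
  by_cases hcM : c ∈ Mv
  · rw [mergeRows_of_mem hcM] at hc' hcoll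
    by_cases hc'M : c' ∈ Mv
    · rw [mergeRows_of_mem hc'M] at hcoll
      obtain ⟨-, hne, heq⟩ := mem_coCurves.mp hc'
      exact ⟨hcM, hc'M, mem_coCurves.mpr ⟨Finset.mem_inter.mpr ⟨hc'T, hc'M⟩, hne, heq⟩, hcoll⟩
    · -- the mover `c` landed on a row blocked (under `r`) by the non-mover `c'`
      rw [mergeRows_of_not_mem hc'M] at hcoll
      exact absurd (mem_blockedRows.mpr ⟨c', hc', hcoll⟩) (ha c hcM)
  · rw [mergeRows_of_not_mem hcM] at hc' hcoll
    by_cases hc'M : c' ∈ Mv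
    · -- the mover `c'` landed on a row blocked (under `r`) by the non-mover `c`
      rw [mergeRows_of_mem hc'M] at hcoll
      have hcc' : c ∈ coCurves T c' (r' c', s₀) := by
        rw [hcoll]; exact mem_coCurves_symm hc hc'
      exact absurd (mem_blockedRows.mpr ⟨c, hcc', hcoll.symm⟩) (ha c' hc'M)
    · -- two non-movers colliding under `r`: impossible
      rw [mergeRows_of_not_mem hc'M] at hcoll
      exact absurd (nonmovers_free hc hcM hc' hcoll) hc'M

open scoped Classical in
/-- **The next round's movers are this round's colliding movers.** [this file] -/
theorem movers_merge_subset {T : Finset (Fin 3 → Fin (qOf m))} {s₀ : Fin m}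
    {r r' : (Fin 3 → Fin (qOf m)) → Fin m} (key : (Fin 3 → Fin (qOf m)) → ℕ)
    (ha : ∀ c ∈ movers T s₀ r key, r' c ∉ blockedRows T c r s₀) :
    movers T s₀ (mergeRows (movers T s₀ r key) r r') key ⊆
      movers (T ∩ movers T s₀ r key) s₀ r' key := by
  intro c hc
  obtain ⟨hcT, c', hc', hcoll, hk⟩ := mem_movers.mp hc
  obtain ⟨hcM, -, hco, hr⟩ := collision_merge key ha hcT hc' hcoll
  exact mem_movers.mpr ⟨Finset.mem_inter.mpr ⟨hcT, hcM⟩, c', hco, hr, hk⟩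

open scoped Classical in
/-- `#movers(r₂) ≤ collCount (T ∩ Mv) s₀ r'`. [this file] -/
theorem card_movers_merge_le {T : Finset (Fin 3 → Fin (qOf m))} {s₀ : Fin m}
    {r r' : (Fin 3 → Fin (qOf m)) → Fin m} (key : (Fin 3 → Fin (qOf m)) → ℕ)
    (ha : ∀ c ∈ movers T s₀ r key, r' c ∉ blockedRows T c r s₀) :
    (movers T s₀ (mergeRows (movers T s₀ r key) r r') key).card ≤
      collCount (T ∩ movers T s₀ r key) s₀ r' :=
  ((Finset.card_le_card (movers_merge_subset key ha)).trans
    (Finset.card_le_card (movers_subset_notFree _ s₀ r' key))).trans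
    (card_notFree_le_collCount _ s₀ r')

open scoped Classical in
/-- In particular, if the movers do not collide among themselves under `r'`
(`collCount (T ∩ Mv) s₀ r' = 0`), the merged assignment has no movers. [this file] -/
theorem movers_merge_eq_empty {T : Finset (Fin 3 → Fin (qOf m))} {s₀ : Fin m}
    {r r' : (Fin 3 → Fin (qOf m)) → Fin m} (key : (Fin 3 → Fin (qOf m)) → ℕ)
    (ha : ∀ c ∈ movers T s₀ r key, r' c ∉ blockedRows T c r s₀)
    (h0 : collCount (T ∩ movers T s₀ r key) s₀ r' = 0) :
    movers T s₀ (mergeRows (movers T s₀ r key) r r') key = ∅ :=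
  Finset.card_eq_zero.mp (Nat.le_zero.mp (h0 ▸ card_movers_merge_le key ha))

/-! ## 2. Blocked rows after a merge -/

open scoped Classical in
/-- **Blocked rows after the merge** come from the old assignment or from movers' landings.
[this file] -/
theorem blockedRows_merge_subset (T Mv : Finset (Fin 3 → Fin (qOf m)))
    (c : Fin 3 → Fin (qOf m)) (r r' : (Fin 3 → Fin (qOf m)) → Fin m) (s₀ : Fin m) :
    blockedRows T c (mergeRows Mv r r') s₀ ⊆
      blockedRows T c r s₀ ∪ blockedRows (T ∩ Mv) c r' s₀ := by
  intro i hi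
  obtain ⟨c', hc', hr⟩ := mem_blockedRows.mp hi
  rw [Finset.mem_union]
  by_cases hc'M : c' ∈ Mv
  · rw [mergeRows_of_mem hc'M] at hr
    obtain ⟨hT, hne, heq⟩ := mem_coCurves.mp hc'
    exact Or.inr (mem_blockedRows.mpr
      ⟨c', mem_coCurves.mpr ⟨Finset.mem_inter.mpr ⟨hT, hc'M⟩, hne, heq⟩, hr⟩)
  · rw [mergeRows_of_not_mem hc'M] at hr
    exact Or.inl (mem_blockedRows.mpr ⟨c', hc', hr⟩)

open scoped Classical in
/-- Cardinal form: `#blockedRows(r₂) ≤ #blockedRows(r) + #blockedRows_{T ∩ Mv}(r')`.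
[this file] -/
theorem card_blockedRows_merge_le (T Mv : Finset (Fin 3 → Fin (qOf m)))
    (c : Fin 3 → Fin (qOf m)) (r r' : (Fin 3 → Fin (qOf m)) → Fin m) (s₀ : Fin m) :
    (blockedRows T c (mergeRows Mv r r') s₀).card ≤
      (blockedRows T c r s₀).card + (blockedRows (T ∩ Mv) c r' s₀).card :=
  (Finset.card_le_card (blockedRows_merge_subset T Mv c r r' s₀)).trans
    (Finset.card_union_le _ _)

/-! ## 3. Termination: no movers -/

open scoped Classical in
/-- No movers ⇒ no collisions at all. [this file] -/
theorem noCollision_of_movers_eq_empty {T : Finset (Fin 3 → Fin (qOf m))} {s₀ : Fin m}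
    {r : (Fin 3 → Fin (qOf m)) → Fin m} {key : (Fin 3 → Fin (qOf m)) → ℕ}
    (h : movers T s₀ r key = ∅) :
    ∀ c ∈ T, ∀ c' ∈ coCurves T c (r c, s₀), r c' ≠ r c := by
  intro c hc c' hc' hrc'
  have hcM : c ∉ movers T s₀ r key := by rw [h]; exact Finset.notMem_empty c
  have := nonmovers_free hc hcM hc' hrc'
  rw [h] at this
  exact Finset.notMem_empty c' this

open scoped Classical in
/-- **Termination, freeness**: no movers ⇒ the pivot column is free at every pivot row.
[this file] -/
theorem free_of_movers_eq_empty {T : Finset (Fin 3 → Fin (qOf m))} {s₀ : Fin m}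
    {r : (Fin 3 → Fin (qOf m)) → Fin m} {key : (Fin 3 → Fin (qOf m)) → ℕ}
    (h : movers T s₀ r key = ∅) : ∀ c ∈ T, s₀ ∈ freeCols T c r (r c) := fun c hc =>
  mem_freeCols.mpr (noCollision_of_movers_eq_empty h c hc)

open scoped Classical in
/-- **Termination, clause 1**: no movers ⇒ injective pivots on `T`. [this file] -/
theorem injective_of_movers_eq_empty {T : Finset (Fin 3 → Fin (qOf m))} {s₀ : Fin m}
    {r : (Fin 3 → Fin (qOf m)) → Fin m} {key : (Fin 3 → Fin (qOf m)) → ℕ}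
    (h : movers T s₀ r key = ∅) :
    ∀ c ∈ T, ∀ c' ∈ T, cellEmb m c (r c, s₀) = cellEmb m c' (r c', s₀) → c = c' := by
  intro c hc c' hc' heq
  by_contra hne
  have hpos := pos_eq_of_cellEmb_eq m heq
  have hrow : r c = r c' := (Prod.ext_iff.mp hpos).1
  have hc'co : c' ∈ coCurves T c (r c, s₀) :=
    mem_coCurves.mpr ⟨hc', fun h' => hne h'.symm, by rw [← hrow] at heq; exact heq.symm⟩
  exact noCollision_of_movers_eq_empty h c hc c' hc'co hrow.symm

/-! ## 4. One round, packaged -/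

open scoped Classical in
/-- **ONE ROUND, PACKAGED.**  From `r` (movers `Mv`) and new rows `r'` for the movers avoiding
the rows blocked under `r`: the merged assignment `r₂` has movers among the `r'`-colliding
movers (at most `collCount (T ∩ Mv) s₀ r'` of them), and its blocked rows are controlled by
those of `r` plus the movers' landings. [this file] -/
theorem round_step {T : Finset (Fin 3 → Fin (qOf m))} {s₀ : Fin m}
    {r r' : (Fin 3 → Fin (qOf m)) → Fin m} (key : (Fin 3 → Fin (qOf m)) → ℕ)
    (ha : ∀ c ∈ movers T s₀ r key, r' c ∉ blockedRows T c r s₀) :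
    movers T s₀ (mergeRows (movers T s₀ r key) r r') key ⊆ movers T s₀ r key ∧
    (movers T s₀ (mergeRows (movers T s₀ r key) r r') key).card ≤
      collCount (T ∩ movers T s₀ r key) s₀ r' ∧
    ∀ c, (blockedRows T c (mergeRows (movers T s₀ r key) r r') s₀).card ≤
      (blockedRows T c r s₀).card + (blockedRows (T ∩ movers T s₀ r key) c r' s₀).card := by
  refine ⟨fun c hc => ?_, card_movers_merge_le key ha, fun c =>
    card_blockedRows_merge_le T _ c r r' s₀⟩
  have h := movers_merge_subset key ha hc
  exact (Finset.mem_inter.mp (mem_movers.mp h).1).2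

end Summit.ValiantsHypothesis.ValiantsHypothesis.Theorems.DefinabilityGapRounds
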